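import Summits.Ventures.HSemireg.WedgeHankelClassSpaceIndecomposable
import Summits.Ventures.HSemireg.WedgeHankelSubstitutionSingularRank
import Mathlib.LinearAlgebra.Vandermonde
import Mathlib.FieldTheory.Finite.Basic

/-!
# Venture HSemireg — THE FINITE FIELD WITH `|K| = n + 1`: th-7's class space of degree `n` is IRREDUCIBLE under the substitution monoid (every non-zero subspace stable under
# all `SbC g`, singular ones included, is `⊤`) — the `n + 1` PURE CLASSES `w_n(c^•)`, `c ∈ K`, are a basis (Vandermonde), a singular substitution `SbC(1 c 0 0)` projects onto
# the pure class of `c`, and the `0`-th moments `Σ_s C(n,s) μ^s q_s` of all substitutes of a class vanish only for the zero class (Vandermonde again, all `C(n,s)` being units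
# since `n + 1 = |K| = p^f`); and `|K| = n`: always REDUCIBLE (`C(n,1) = |K| = 0` in `K`) — the two cards left open between K4 (`|K| < n`) and K3 (`|K| ≥ n + 2`)

HONEST FRAMING. Part of the Lean index of the computation cell `pub-hsemireg` (seat p10 gen 22, Sunday typer «UNIFORM-IN-n»).
Finite-dimensional EXTERIOR ALGEBRA + linear algebra + finite-field counting ONLY: no variety, no cohomology theory, no sheaf, no Ext group, no semiregularity map;
nothing here says that HC / HC_CM / HC_AV holds; no Literature fact is declared or used.  Custodian versions as in `WedgeHankelSiegelIdeal` (1/3) and `WedgeHankelFrameChange`;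
the dictionary (binary forms of degree `q − 1` over `𝔽_q` under ALL linear substitutions, singular included; cf. the Steinberg module for the invertible ones) is QUOTED, never asserted.

WHAT IS IN THE TREE.  K3 (`…IrreducibleCharP`): irreducible ⇔ all `C(n,j)` units GIVEN `t ∈ K` with `n + 1` distinct powers (needs `|K| ≥ n + 2`), `SbC_mem_comap_siegel` /
`comap_siegel_ne_top` / `comap_siegel_eq_bot_iff`; K4 (`…ReducibleFinite`): `|K| < n` ⇒ reducible (the rational point classes); K9/J16 `coSiegel_inf_siegelIdeal_eq_bot_iff_exists_digits`;
H1 `Sb_w_rank_one` (`Sb(1 λ 0 0) w_n(q) = w_n(q_0 λ^•)`), I2 `sbSeq_apply_zero_eq_sum` (`0`-th moment `Σ_s C(m,s) α^{m−s}γ^s q_s`), J10 `exists_coe_eq_w`, gen-11 `w_eq_sum_spikes`; Mathlib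
`Matrix.det_vandermonde_ne_zero_iff`, `FiniteField.card`.  K4's header: «NOT typed: `|K| = n` and `n + 1` (Vandermonde)».  THIS FILE (namespace
`Summit.Ventures.HSemireg.Wedge.HankelFrameChange` continued; imports K9, J10, Mathlib Vandermonde + finite fields):
* §341 COORDINATES: `mk_w_eq_sum`, **`repr_mk_w`** (`repr w_n(q) p = q_p`), **`SbC_rank_one_apply`** (`SbC(1 c 0 0) f = (repr f 0) • w_n(c^•)`: a singular substitution projects
  onto a pure class), **`repr_SbC_mk_w_zero`** (`repr (SbC g w_n(q)) 0 = Σ_s C(n,s) α^{n−s} γ^s q_s`, the `0`-th moment).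
* §342 VANDERMONDE OVER THE WHOLE FIELD (`|K| = n + 1`): `eq_zero_of_forall_sum_pow_mul_eq_zero` (`Σ_s μ^s x_s = 0` for all `μ ∈ K` ⇒ `x = 0`), **`linearIndependent_pure_classes`**
  (the `n + 1` pure classes `w_n(c^•)`, `c ∈ K`, are independent), **`span_pure_classes_eq_top`** (a basis of the class space).
* §343 **`choose_ne_zero_of_card_eq_succ`** (`|K| = n + 1 = p^f` ⇒ every `C(n,j)` is a unit), **`eq_top_of_forall_SbC_stable_of_card_eq_succ`** and
  **`forall_stable_eq_top_of_card_eq_succ`: `|K| = n + 1` ⇒ IRREDUCIBLE under all substitutions**; **`exists_stable_ne_bot_ne_top_of_card_eq`: `|K| = n ≥ 1` ⇒ REDUCIBLE**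
  (`C(n,1) = 0` in `K`: the Siegel classes), `not_forall_stable_eq_top_of_card_eq`.
NOT typed here: `|K| = n + 1` under the INVERTIBLE substitutions only (the Steinberg module of `GL₂(𝔽_q)`; the singular projections are used essentially here); anything Ext-side.
New names only.
-/

open Module

namespace Summit.Ventures.HSemireg.Wedge.HankelFrameChange

open Summit.Ventures.HSemireg.Wedge Summit.Ventures.HSemireg.Wedge.Kunneth Summit.Ventures.HSemireg.Wedge.Hankel
  Summit.Ventures.HSemireg.Wedge.BasisFree Summit.Ventures.HSemireg.Wedge.HankelSiegel Summit.Ventures.HSemireg.Wedge.HankelSiegelIdeal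
  Summit.Ventures.HSemireg.Wedge.KunnethKernel Summit.Ventures.HSemireg.Wedge.HankelRankOne Summit.Ventures.HSemireg.Wedge.KernelDuality

variable (K : Type*) [Field K] {n : ℕ}

/-! ## §341. Coordinates of a class, the singular projections, the `0`-th moment -/

/-- `w_n(q) = Σ_p q_p • E_p` in the class space. -/
theorem mk_w_eq_sum (q : ℕ → K) : (⟨w K n n q, w_mem_spikeSpan K q⟩ : spikeSpan K n) = ∑ p : Fin (n + 1), q p • spikeBasis K n p := by
  apply Subtype.ext
  simp only [Submodule.coe_sum, Submodule.coe_smul, spikeBasis_coe]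
  rw [w_eq_sum_spikes K q, Finset.sum_range (fun p => q p • w K n n (fun j => if j = p then (1 : K) else 0))]

/-- **the spike coordinates of `w_n(q)` are `q_0, …, q_n`.** -/
theorem repr_mk_w (q : ℕ → K) (p : Fin (n + 1)) : (spikeBasis K n).repr (⟨w K n n q, w_mem_spikeSpan K q⟩ : spikeSpan K n) p = q p := by
  rw [mk_w_eq_sum, show (∑ p : Fin (n + 1), q p • spikeBasis K n p) = ∑ p : Fin (n + 1), (fun p : Fin (n + 1) => q p) p • spikeBasis K n p from rfl, Basis.repr_sum_self]

/-- **A SINGULAR SUBSTITUTION PROJECTS ONTO A PURE CLASS: `SbC(1 c 0 0) f = (repr f 0) • w_n(c^•)`** (H1 `Sb_w_rank_one`). -/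
theorem SbC_rank_one_apply (c : K) (f : spikeSpan K n) :
    SbC K 1 c 0 0 f = (spikeBasis K n).repr f 0 • (⟨w K n n (fun j => c ^ j), w_mem_spikeSpan K _⟩ : spikeSpan K n) := by
  obtain ⟨q, hq⟩ := exists_coe_eq_w K f
  have hf : f = ⟨w K n n q, w_mem_spikeSpan K q⟩ := Subtype.ext hq
  rw [hf, repr_mk_w]
  apply Subtype.ext
  rw [SbC_apply_coe, Submodule.coe_smul, Sb_w_rank_one K c le_rfl, ← w_smul]
  rfl

/-- **THE `0`-TH MOMENT: `repr (SbC(α β γ δ) w_n(q)) 0 = Σ_{s ≤ n} C(n,s) α^{n−s} γ^s q_s`** (I2). -/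
theorem repr_SbC_mk_w_zero (α β γ δ : K) (q : ℕ → K) :
    (spikeBasis K n).repr (SbC K α β γ δ ⟨w K n n q, w_mem_spikeSpan K q⟩) 0 = ∑ s ∈ Finset.range (n + 1), (n.choose s : K) * α ^ (n - s) * γ ^ s * q s := by
  have h : SbC K α β γ δ (⟨w K n n q, w_mem_spikeSpan K q⟩ : spikeSpan K n) = ⟨w K n n (sbSeq K α β γ δ n q), w_mem_spikeSpan K _⟩ :=
    Subtype.ext (by rw [SbC_apply_coe, Sb_w K α β γ δ le_rfl])
  rw [h, repr_mk_w, Fin.val_zero, sbSeq_apply_zero_eq_sum]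

/-! ## §342. Vandermonde over the whole field -/

section Card

variable [Fintype K]

/-- **`|K| = n + 1`: if `Σ_s μ^s x_s = 0` for every `μ ∈ K` then `x = 0`** (the Vandermonde matrix of all of `K` is invertible). -/
theorem eq_zero_of_forall_sum_pow_mul_eq_zero (hK : Fintype.card K = n + 1) (x : Fin (n + 1) → K) (h : ∀ μ : K, ∑ s : Fin (n + 1), μ ^ (s : ℕ) * x s = 0) : x = 0 := by
  have hdet : (Matrix.vandermonde fun i : Fin (n + 1) => (Fintype.equivFinOfCardEq hK).symm i).det ≠ 0 :=
    Matrix.det_vandermonde_ne_zero_iff.mpr (Fintype.equivFinOfCardEq hK).symm.injective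
  refine Matrix.eq_zero_of_mulVec_eq_zero hdet (funext fun i => ?_)
  rw [Matrix.mulVec, dotProduct, Pi.zero_apply]
  simp only [Matrix.vandermonde_apply]
  exact h _

/-- **`|K| = n + 1`: THE `n + 1` PURE CLASSES `w_n(c^•)`, `c ∈ K`, ARE LINEARLY INDEPENDENT** (their spike coordinates are the rows `(1, c, …, c^n)` of the Vandermonde matrix). -/
theorem linearIndependent_pure_classes (hK : Fintype.card K = n + 1) :
    LinearIndependent K fun c : K => (⟨w K n n (fun j => c ^ j), w_mem_spikeSpan K _⟩ : spikeSpan K n) := by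
  rw [Fintype.linearIndependent_iff]
  intro g hg
  have hdet : (Matrix.vandermonde fun i : Fin (n + 1) => (Fintype.equivFinOfCardEq hK).symm i).det ≠ 0 :=
    Matrix.det_vandermonde_ne_zero_iff.mpr (Fintype.equivFinOfCardEq hK).symm.injective
  -- the coordinates of the relation: `Σ_c g c · c^p = 0` for every `p`
  have hp : ∀ p : Fin (n + 1), ∑ c : K, g c * c ^ (p : ℕ) = 0 := fun p => by
    have h := congrArg (fun f : spikeSpan K n => (spikeBasis K n).repr f p) hg
    simpa only [map_sum, map_smul, map_zero, Finsupp.finsetSum_apply, Finsupp.smul_apply, smul_eq_mul, Finsupp.zero_apply, repr_mk_w] using h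
  -- reindex by `Fin (n + 1) ≃ K` and apply Vandermonde
  have hy : (fun i : Fin (n + 1) => g ((Fintype.equivFinOfCardEq hK).symm i)) = 0 := by
    refine Matrix.eq_zero_of_vecMul_eq_zero hdet (funext fun p => ?_)
    rw [Matrix.vecMul, dotProduct, Pi.zero_apply]
    simp only [Matrix.vandermonde_apply]
    rw [← hp p]
    exact (Fintype.equivFinOfCardEq hK).symm.sum_comp (fun c : K => g c * c ^ (p : ℕ))
  intro c
  have h := congrFun hy ((Fintype.equivFinOfCardEq hK) c)
  rwa [Equiv.symm_apply_apply] at h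

/-- **`|K| = n + 1`: the pure classes span th-7's class space** (a basis). -/
theorem span_pure_classes_eq_top (hK : Fintype.card K = n + 1) :
    Submodule.span K (Set.range fun c : K => (⟨w K n n (fun j => c ^ j), w_mem_spikeSpan K _⟩ : spikeSpan K n)) = ⊤ :=
  (linearIndependent_pure_classes K hK).span_eq_top_of_card_eq_finrank' (by rw [hK, finrank_eq_card_basis (spikeBasis K n), Fintype.card_fin])

/-! ## §343. `|K| = n + 1`: irreducible; `|K| = n`: reducible -/

/-- **`|K| = n + 1 = p^f` ⇒ every `C(n,j)`, `j ≤ n`, is non-zero in `K`** (J16's digit criterion with `d = 0`). -/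
theorem choose_ne_zero_of_card_eq_succ (hK : Fintype.card K = n + 1) (j : ℕ) (hj : j ≤ n) : ((n.choose j : ℕ) : K) ≠ 0 := by
  obtain ⟨p, hchar⟩ := CharP.exists K
  haveI := hchar
  obtain ⟨f, hp, hcard⟩ := FiniteField.card K p
  refine (coSiegel_inf_siegelIdeal_eq_bot_iff K).mp ((coSiegel_inf_siegelIdeal_eq_bot_iff_exists_digits K p hp).mpr ⟨(f : ℕ), 0, hp.pos, ?_⟩) j hj
  rw [zero_add, one_mul, ← hK, hcard]

/-- **`|K| = n + 1`: EVERY NON-ZERO SUBSPACE OF TH-7's CLASS SPACE STABLE UNDER ALL SUBSTITUTIONS IS `⊤`.**  If some class in `W` has a non-zero pure coordinate `q_0`, the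
singular projections put every pure class `w_n(c^•)` in `W`, and these span; otherwise all `0`-th moments `Σ_s C(n,s) μ^s q_s` of the substitutes of every `w_n(q) ∈ W` vanish,
so `C(n,s) q_s = 0` for all `s` (Vandermonde), so `q = 0` (the binomials are units) — `W = ⊥`. -/
theorem eq_top_of_forall_SbC_stable_of_card_eq_succ (hK : Fintype.card K = n + 1) {W : Submodule K (spikeSpan K n)}
    (hall : ∀ α β γ δ : K, ∀ f ∈ W, SbC K α β γ δ f ∈ W) (hW : W ≠ ⊥) : W = ⊤ := by
  by_cases h0 : ∃ f ∈ W, (spikeBasis K n).repr f 0 ≠ 0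
  · obtain ⟨f, hf, hf0⟩ := h0
    have hP : ∀ c : K, (⟨w K n n (fun j => c ^ j), w_mem_spikeSpan K _⟩ : spikeSpan K n) ∈ W := fun c => by
      have h := hall 1 c 0 0 f hf
      rw [SbC_rank_one_apply] at h
      have h' := W.smul_mem ((spikeBasis K n).repr f 0)⁻¹ h
      rwa [smul_smul, inv_mul_cancel₀ hf0, one_smul] at h'
    rw [eq_top_iff, ← span_pure_classes_eq_top K hK, Submodule.span_le]
    rintro _ ⟨c, rfl⟩
    exact hP c
  · push Not at h0
    exfalso
    apply hW
    rw [eq_bot_iff]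
    intro f hf
    obtain ⟨q, hq⟩ := exists_coe_eq_w K f
    have hf' : f = ⟨w K n n q, w_mem_spikeSpan K q⟩ := Subtype.ext hq
    -- all `0`-th moments vanish
    have hx : (fun s : Fin (n + 1) => ((n.choose (s : ℕ) : ℕ) : K) * q s) = 0 :=
      eq_zero_of_forall_sum_pow_mul_eq_zero K hK _ fun μ => by
        have h := h0 _ (hall 1 0 μ 0 f hf)
        rw [hf', repr_SbC_mk_w_zero, Finset.sum_range (fun s => ((n.choose s : ℕ) : K) * (1 : K) ^ (n - s) * μ ^ s * q s)] at h
        rw [← h]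
        exact Finset.sum_congr rfl fun s _ => by rw [one_pow, mul_one]; ring
    -- hence `q_s = 0` for `s ≤ n`
    have hq0 : ∀ s : Fin (n + 1), q s = 0 := fun s => by
      have h := congrFun hx s
      rw [Pi.zero_apply, mul_eq_zero] at h
      exact h.resolve_left (choose_ne_zero_of_card_eq_succ K hK s (Nat.le_of_lt_succ s.2))
    rw [Submodule.mem_bot, hf', mk_w_eq_sum]
    exact Finset.sum_eq_zero fun s _ => by rw [hq0 s, zero_smul]

/-- **`|K| = n + 1`: th-7's class space of degree `n` is IRREDUCIBLE under the substitution monoid** — the card at which K3's hypothesis first fails (`|K| ≤ n + 1`: no element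
with `n + 1` distinct powers) and K4's point classes first span. -/
theorem forall_stable_eq_top_of_card_eq_succ (hK : Fintype.card K = n + 1) :
    ∀ W : Submodule K (spikeSpan K n), (∀ α β γ δ : K, ∀ f ∈ W, SbC K α β γ δ f ∈ W) → W ≠ ⊥ → W = ⊤ :=
  fun _ hall hW => eq_top_of_forall_SbC_stable_of_card_eq_succ K hK hall hW

/-- **`|K| = n`, `n ≥ 1`: th-7's class space of degree `n` is REDUCIBLE** — `C(n,1) = n = |K| = 0` in `K`, so the Siegel classes are a proper non-zero subspace stable under every
substitution (K3). -/
theorem exists_stable_ne_bot_ne_top_of_card_eq (hK : Fintype.card K = n) (hn : 1 ≤ n) :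
    ∃ W : Submodule K (spikeSpan K n), (∀ α β γ δ : K, ∀ f ∈ W, SbC K α β γ δ f ∈ W) ∧ W ≠ ⊥ ∧ W ≠ ⊤ := by
  refine ⟨Submodule.comap (spikeSpan K n).subtype (coSiegel K n n ⊓ siegelIdeal K n n), fun α β γ δ f hf => SbC_mem_comap_siegel K α β γ δ hf, fun hb => ?_,
    comap_siegel_ne_top K⟩
  have h1 := (comap_siegel_eq_bot_iff K).mp hb 1 hn
  rw [Nat.choose_one_right, ← hK] at h1
  exact h1 (FiniteField.cast_card_eq_zero K)

/-- hence for `|K| = n ≥ 1` NOT every non-zero stable subspace is `⊤`. -/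
theorem not_forall_stable_eq_top_of_card_eq (hK : Fintype.card K = n) (hn : 1 ≤ n) :
    ¬ ∀ W : Submodule K (spikeSpan K n), (∀ α β γ δ : K, ∀ f ∈ W, SbC K α β γ δ f ∈ W) → W ≠ ⊥ → W = ⊤ := by
  obtain ⟨W, hW, hb, ht⟩ := exists_stable_ne_bot_ne_top_of_card_eq K hK hn
  exact fun h => ht (h W hW hb)

end Card

end Summit.Ventures.HSemireg.Wedge.HankelFrameChange
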